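import Summits.ABC.FunctionField.TransferSheet
import Literature.Barriers.ABC.NoArithmeticDerivativeAbcEstimateProofs
import Literature.NumberTheory.EllipticCurves.SzpiroOfAbcProofs
import Mathlib.Analysis.SpecialFunctions.Pow.Asymptotics
import HarnessLib
import HarnessLib.Audit

/-!
# Cell abc-ff — transfer sheet, chain (c) MASON: the hits-only Small-Derivatives requirement and its
# sorry-free skeleton to `ABC` (Pasten's Lemma 4.1 in quantitative form, PROVED)

`Summits/ABC/FunctionField/TransferSheetMason.lean` (cell abc-ff; mathematics and Lean by the cell's
MASON lens seat abc-ff-lens-3, `HOME/lens-3/MasonSheet.lean`, farm rc 0; landed by the typer in the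
sheet's currency `PolyAbcWith`). HONESTY: abc is not proved by any of this; every `def … : Prop` below
is a conjectural REQUIREMENT used only as a hypothesis (D-0139/D-0140); typed ≠ proved.

Row MS-5 of the sheet (the degree drop `deg W(a,b) < deg a + deg b` of the Wronskian,
`Polynomial.natDegree_wronskian_lt_add`) is the first non-transferring step of the Mason–Stothers proof:
over `ℤ` Pasten's arithmetic derivatives `d^ψ` (`Literature.Barriers.ABC.arithDerivWith`) exist, are
Leibniz, additive on the one equation `a + b = c` (`Pasten.IsAdapted`), independent ones exist with
`‖ψ‖ ≤ ω(abc) c log c / (2 log 2)` (`Pasten.exists_adapted_independent_holds`), and Snyder's count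
transfers verbatim (`Pasten.abc_estimate_holds`: `c / log c ≤ rad(abc) ‖ψ‖ / log 2`) — what does NOT
transfer is the SIZE of the derivative. The replacement is Pasten's Small Derivatives Conjecture with
exponent `η` (`Literature.Barriers.ABC.Pasten.SmallDerivativesConjectureWith η`, cited by name in the
sheet). This file records lens-3's sharpening of the row:

* `SmallDerivativesOnHitsWith η` — the same requirement restricted to abc-HITS `rad(abc) < c` (the only
  triples on which it is used), and its `η → 0⁺` envelope `SmallDerivativesOnHitsAllExponents`;
* `polyAbcWith_of_smallDerivativesOnHitsWith` — **Pasten's Lemma 4.1 in the printed quantitative form,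
  PROVED**: for `0 < η < 1` the hits-only requirement gives `PolyAbcWith M` for EVERY `M > 1/(1 − η)`
  (the tree's `Pasten.exists_exponent_of_smallDerivatives_holds` has only `∃ M`); «NOT abc — POLY-abc(M)»;
* `abc_of_smallDerivativesOnHitsAllExponents : … → ABC` and `szpiro_of_… : … → SzpiroConjecture` —
  the sorry-free skeleton of chain (c) to rung A0 (ONE hypothesis, the requirement), and the same from
  the all-triples envelope `SmallDerivativesAllExponents` of the sheet;
* `not_smallDerivativesWith_of_nonpos` — the exact transcription `η ≤ 0` is FALSE as typed (trivially:
  `‖ψ‖ < 1` forces `ψ = 0`); the honest `η = 0` analogue, a polylog bound, is refuted by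
  `Literature.Barriers.ABC.EpsilonCannotBeDropped` (Stewart–Tijdeman).
STRENGTH (referee B): for fixed `η` A-PS-type («POLY-abc(M > 1/(1−η))»; ⇒ POLY-SZPIRO only for
`η < 1/6`); the envelope reaches A0 but is NOT known to follow from abc (abc gives `η > 3/4` only,
Pasten Thm. 4.5) — «≥ abc», not an opening. The all-triples envelope is moreover false under a
Schinzel-type hypothesis on the prime pairs `(p, (p²+1)/2)` (lens-3's rigid family; separate file).
Source: H. Pasten, *Arithmetic derivatives through geometry of numbers*, Conj. 3.9, Thm. 3.3,
Lemma 3.5, Lemma 4.1, Thm. 4.5 [cite: Pasten2021, Lemma 4.1].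
-/

noncomputable section

open Literature.NumberTheory.DiophantineGeometry
open Literature.Barriers.ABC

namespace Summit.ABC.FunctionField

/-! ## The hits-only requirement (row CF-3, lens-3's R1′) -/

/-- **`R_MS(η)` restricted to abc-hits** (lens-3's R1′(η); a NEW statement, weaker than Pasten's
`SmallDerivativesConjectureWith η`, see `smallDerivativesOnHitsWith_of_smallDerivativesWith`): for all
but finitely many abc triples with `rad(abc) < c` that are not of the excluded form `(1, N, q)` there is
an adapted (`Pasten.IsAdapted`), independent (`Pasten.wronskian ψ a b ≠ 0`) arithmetic derivative with
`|ψ(p)| < c^η` for all `p`. CONJECTURAL REQUIREMENT (open for `0 < η < 1`), used only as a hypothesis;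
for fixed `η` its strength is «NOT abc — POLY-abc(M) for every M > 1/(1−η)»
(`polyAbcWith_of_smallDerivativesOnHitsWith`). D-0139/D-0140: a requirement row, not a claim.
[folklore] -/
@[conjecture] def SmallDerivativesOnHitsWith (η : ℝ) : Prop :=
  {t : ℕ × ℕ × ℕ | IsABCTriple t.1 t.2.1 t.2.2 ∧ ¬ Pasten.IsExcludedTriple t.1 t.2.1 t.2.2 ∧
      rad t.1 t.2.1 t.2.2 < t.2.2 ∧
      ¬ ∃ ψ : ℕ → ℤ, Pasten.IsAdapted ψ t.1 t.2.1 ∧ Pasten.wronskian ψ t.1 t.2.1 ≠ 0 ∧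
          ∀ p : ℕ, (|ψ p| : ℝ) < (t.2.2 : ℝ) ^ η}.Finite

/-- Pasten's `SmallDerivativesConjectureWith η` implies the hits-only requirement (a sub-family of a
finite family is finite). [folklore] -/
theorem smallDerivativesOnHitsWith_of_smallDerivativesWith {η : ℝ}
    (h : Pasten.SmallDerivativesConjectureWith η) : SmallDerivativesOnHitsWith η :=
  h.subset fun _ ht => ⟨ht.1, ht.2.1, ht.2.2.2⟩

/-- **Lens-3's repaired crux R1′ = `R_MS(0⁺)` on abc-hits**: `SmallDerivativesOnHitsWith η` for EVERY
`η > 0`. CONJECTURAL REQUIREMENT, open; STRENGTH A0 (`abc_of_smallDerivativesOnHitsAllExponents`) but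
«≥ abc»: abc is only known to give it for `η > 3/4` (Pasten Thm. 4.5), so for the census it is not an
opening. PATH: a power saving over the Bombieri–Vaaler bound in Pasten's lattice `𝒯(a,b)` along
abc-hits, `η → 0⁺` (none known). EFFECTIVE: no. WHY IT MIGHT FAIL: an infinite family of abc-hits with
bounded `ω(abc)` and rigid coefficients. D-0139/D-0140: a requirement row, not a claim. [folklore] -/
@[conjecture] def SmallDerivativesOnHitsAllExponents : Prop :=
  ∀ η : ℝ, 0 < η → SmallDerivativesOnHitsWith η

/-- The sheet's all-triples envelope `SmallDerivativesAllExponents` implies the hits-only one.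
[folklore] -/
theorem smallDerivativesOnHitsAllExponents_of_allExponents (h : SmallDerivativesAllExponents) :
    SmallDerivativesOnHitsAllExponents :=
  fun η hη => smallDerivativesOnHitsWith_of_smallDerivativesWith (h η hη)

/-! ## Pasten's Lemma 4.1, quantitative form (PROVED) -/

/-- Asymptotic input for Lemma 4.1: for `δ > 0`, `(log x)^M ≤ (log 2)^M · x^δ` for all `x ≥ N₁(M, δ)`
(Mathlib `isLittleO_log_rpow_rpow_atTop`). [folklore] -/
theorem exists_log_rpow_le (M δ : ℝ) (hδ : 0 < δ) :
    ∃ N₁ : ℝ, ∀ x : ℝ, N₁ ≤ x → Real.log x ^ M ≤ Real.log 2 ^ M * x ^ δ := by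
  have hlog2 : 0 < Real.log 2 := Real.log_pos one_lt_two
  have ho := isLittleO_log_rpow_rpow_atTop M hδ
  have hb := ho.bound (Real.rpow_pos_of_pos hlog2 M)
  obtain ⟨N, hN⟩ := Filter.eventually_atTop.mp hb
  refine ⟨max N 1, fun x hx => ?_⟩
  have hxN : N ≤ x := le_trans (le_max_left _ _) hx
  have hx1 : 1 ≤ x := le_trans (le_max_right _ _) hx
  have h := hN x hxN
  rwa [Real.norm_of_nonneg (Real.rpow_nonneg (Real.log_nonneg hx1) _),
    Real.norm_of_nonneg (Real.rpow_nonneg (by linarith) _)] at h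

/-- **Pasten's Lemma 4.1, quantitative and from hits only (PROVED; lens-3).** For `0 < η < 1`,
`SmallDerivativesOnHitsWith η` gives `PolyAbcWith M` — `c ≤ K · rad(abc)^M` for ALL abc triples — for
EVERY `M > 1/(1 − η)`. As printed: outside the finite exceptional set (bounded by `N₀`) an abc-hit
carries `ψ` with `‖ψ‖ < c^η`, and Theorem 3.3 (`Pasten.abc_estimate_holds`) gives
`c^{1−η} ≤ rad(abc) · log c / log 2`; raising to the power `M` and using
`(log c / log 2)^M ≤ c^{(1−η)M − 1}` for `c ≥ N₁` gives `c ≤ rad(abc)^M`; excluded triples have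
`c < rad(abc)` (`Pasten.lt_rad_of_isExcludedTriple`) or are `(1,1,2)`; non-hits have `c ≤ rad(abc)`;
small `c` is absorbed in `K = max N₁ 2 + N₀`. For fixed `η` this is «NOT abc — POLY-abc(M)» at all
heights; the constant `K` is ineffective (it depends on the unknown exceptional set).
[cite: Pasten2021, Lemma 4.1] -/
theorem polyAbcWith_of_smallDerivativesOnHitsWith {η : ℝ} (hη0 : 0 < η) (hη1 : η < 1)
    (hfin : SmallDerivativesOnHitsWith η) {M : ℝ} (hM : 1 / (1 - η) < M) : PolyAbcWith M := by
  have h1η : 0 < 1 - η := by linarith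
  have hM1 : 1 < M := by
    have : 1 ≤ 1 / (1 - η) := by rw [le_div_iff₀ h1η]; linarith
    linarith
  have hM0 : 0 < M := by linarith
  set δ : ℝ := (1 - η) * M - 1 with hδ
  have hδ0 : 0 < δ := by
    have h : 1 < (1 - η) * M := by
      have := (div_lt_iff₀' h1η).mp hM
      linarith
    rw [hδ]; linarith
  have hlog2 : 0 < Real.log 2 := Real.log_pos one_lt_two
  obtain ⟨N₁, hN₁⟩ := exists_log_rpow_le M δ hδ0
  -- the exceptional set of the Small Derivatives Conjecture
  set S : Set (ℕ × ℕ × ℕ) := {t : ℕ × ℕ × ℕ | IsABCTriple t.1 t.2.1 t.2.2 ∧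
      ¬ Pasten.IsExcludedTriple t.1 t.2.1 t.2.2 ∧ rad t.1 t.2.1 t.2.2 < t.2.2 ∧
      ¬ ∃ ψ : ℕ → ℤ, Pasten.IsAdapted ψ t.1 t.2.1 ∧ Pasten.wronskian ψ t.1 t.2.1 ≠ 0 ∧
          ∀ p : ℕ, (|ψ p| : ℝ) < (t.2.2 : ℝ) ^ η} with hS_def
  have hSfin : S.Finite := hfin
  obtain ⟨N₀, hN₀⟩ := (hSfin.image fun t : ℕ × ℕ × ℕ => t.2.2).bddAbove
  set K : ℝ := max N₁ 2 + (N₀ : ℝ) with hK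
  have hN0nn : (0 : ℝ) ≤ N₀ := Nat.cast_nonneg _
  have hK2 : 2 ≤ K := by have := le_max_right N₁ 2; linarith
  have hK1 : 1 ≤ K := by linarith
  have hK0 : 0 ≤ K := by linarith
  have hKN1 : N₁ ≤ K := by have := le_max_left N₁ 2; linarith
  have hKN0 : (N₀ : ℝ) ≤ K := by have : (0:ℝ) ≤ max N₁ 2 := le_trans (by norm_num) (le_max_right _ _); linarith
  refine ⟨K, fun a b c habc => ?_⟩
  have hrad1nat : 1 ≤ rad a b c := by
    rw [rad_def]; exact Nat.succ_le_of_lt (Nat.radical_pos _)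
  have hrad1 : (1 : ℝ) ≤ (rad a b c : ℝ) := by exact_mod_cast hrad1nat
  have hrad0 : (0 : ℝ) ≤ (rad a b c : ℝ) := by linarith
  have hradM1 : (1 : ℝ) ≤ (rad a b c : ℝ) ^ M := Real.one_le_rpow hrad1 hM0.le
  have hradM0 : (0 : ℝ) ≤ (rad a b c : ℝ) ^ M := by linarith
  have small : (c : ℝ) ≤ K → (c : ℝ) ≤ K * ((rad a b c : ℕ) : ℝ) ^ M := fun h =>
    h.trans (le_mul_of_one_le_right hK0 hradM1)
  by_cases hmem : (a, b, c) ∈ S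
  · -- exceptional triple: `c ≤ N₀`
    have hc : c ≤ N₀ := hN₀ (Set.mem_image_of_mem (fun t : ℕ × ℕ × ℕ => t.2.2) hmem)
    exact small ((show (c : ℝ) ≤ N₀ by exact_mod_cast hc).trans hKN0)
  · have hS' : ¬ Pasten.IsExcludedTriple a b c → rad a b c < c →
        ∃ ψ : ℕ → ℤ, Pasten.IsAdapted ψ a b ∧ Pasten.wronskian ψ a b ≠ 0 ∧
          ∀ p : ℕ, (|ψ p| : ℝ) < (c : ℝ) ^ η := by
      intro hex hhit
      by_contra hψ
      exact hmem ⟨habc, hex, hhit, hψ⟩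
    have hradself : (rad a b c : ℝ) ≤ (rad a b c : ℝ) ^ M := by
      calc (rad a b c : ℝ) = (rad a b c : ℝ) ^ (1 : ℝ) := (Real.rpow_one _).symm
        _ ≤ (rad a b c : ℝ) ^ M := Real.rpow_le_rpow_of_exponent_le hrad1 hM1.le
    obtain ⟨ha, hb, hsum, hcop⟩ := habc
    by_cases h11 : (a, b) = (1, 1)
    · -- `(1, 1, 2)`
      simp only [Prod.mk.injEq] at h11
      obtain ⟨rfl, rfl⟩ := h11
      subst hsum
      exact small (by simp only [Nat.reduceAdd, Nat.cast_ofNat]; exact hK2)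
    by_cases hex : Pasten.IsExcludedTriple a b c
    · -- excluded: `c < rad(abc)`
      have hlt := Pasten.lt_rad_of_isExcludedTriple ⟨ha, hb, hsum, hcop⟩ hex h11
      have h1 : (c : ℝ) ≤ (rad a b c : ℝ) := by exact_mod_cast hlt.le
      exact (h1.trans hradself).trans (le_mul_of_one_le_left hradM0 hK1)
    by_cases hhit : rad a b c < c
    swap
    · -- not an abc-hit: `c ≤ rad(abc) ≤ K · rad(abc)^M`
      have h1 : (c : ℝ) ≤ (rad a b c : ℝ) := by exact_mod_cast not_lt.mp hhit
      exact (h1.trans hradself).trans (le_mul_of_one_le_left hradM0 hK1)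
    obtain ⟨ψ, had, hW, hsmall⟩ := hS' hex hhit
    by_cases hcN : (c : ℝ) < N₁
    · exact small (hcN.le.trans hKN1)
    have hcN' : N₁ ≤ (c : ℝ) := not_lt.mp hcN
    -- main case: Pasten's estimate with `B = c^η`, then the asymptotic input
    subst hsum
    set x : ℝ := ((a + b : ℕ) : ℝ) with hx
    have hx2 : (2 : ℝ) ≤ x := by rw [hx]; exact_mod_cast (show 2 ≤ a + b by omega)
    have hx0 : 0 < x := by linarith
    have hlogx : 0 < Real.log x := Real.log_pos (by linarith)
    have hxη : 0 < x ^ η := Real.rpow_pos_of_pos hx0 η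
    set R : ℝ := (rad a b (a + b) : ℝ) with hR
    have hB : ∀ p : ℕ, (|ψ p| : ℝ) ≤ x ^ η := fun p => (hsmall p).le
    have hest := Pasten.abc_estimate_holds a b ψ (x ^ η) ⟨ha, hb, rfl, hcop⟩ h11 had hW hB
    -- hest : x / log x ≤ R * x ^ η / log 2
    have hest' : x * Real.log 2 ≤ R * x ^ η * Real.log x := by
      have h := mul_le_mul_of_nonneg_right ((div_le_iff₀ hlogx).mp hest) hlog2.le
      have hlog2ne : Real.log 2 ≠ 0 := hlog2.ne'
      calc x * Real.log 2 ≤ R * x ^ η / Real.log 2 * Real.log x * Real.log 2 := h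
        _ = R * x ^ η * Real.log x := by field_simp
    have step1 : x ^ (1 - η) ≤ R * (Real.log x / Real.log 2) := by
      rw [Real.rpow_sub hx0, Real.rpow_one, div_le_iff₀ hxη,
        show R * (Real.log x / Real.log 2) * x ^ η = R * x ^ η * Real.log x / Real.log 2 by ring,
        le_div_iff₀ hlog2]
      exact hest'
    have hq0 : 0 ≤ Real.log x / Real.log 2 := div_nonneg hlogx.le hlog2.le
    have step2 : x ^ ((1 - η) * M) ≤ R ^ M * (Real.log x / Real.log 2) ^ M := by
      rw [Real.rpow_mul hx0.le, ← Real.mul_rpow hrad0 hq0]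
      exact Real.rpow_le_rpow (Real.rpow_nonneg hx0.le _) step1 hM0.le
    have step3 : (Real.log x / Real.log 2) ^ M ≤ x ^ δ := by
      rw [Real.div_rpow hlogx.le hlog2.le, div_le_iff₀ (Real.rpow_pos_of_pos hlog2 M)]
      have := hN₁ x hcN'
      linarith
    have step4 : x * x ^ δ ≤ R ^ M * x ^ δ := by
      have hxsplit : x ^ ((1 - η) * M) = x * x ^ δ := by
        rw [show (1 - η) * M = 1 + δ by rw [hδ]; ring, Real.rpow_add hx0, Real.rpow_one]
      rw [← hxsplit]
      exact step2.trans (mul_le_mul_of_nonneg_left step3 hradM0)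
    have step5 : x ≤ R ^ M := le_of_mul_le_mul_right step4 (Real.rpow_pos_of_pos hx0 δ)
    exact step5.trans (le_mul_of_one_le_left hradM0 hK1)

/-- Lemma 4.1 from Pasten's all-triples conjecture with exponent `η` (the sheet's `R_MS(η)`),
quantitative: `PolyAbcWith M` for every `M > 1/(1 − η)`. [cite: Pasten2021, Lemma 4.1] -/
theorem polyAbcWith_of_smallDerivativesWith {η : ℝ} (hη0 : 0 < η) (hη1 : η < 1)
    (h : Pasten.SmallDerivativesConjectureWith η) {M : ℝ} (hM : 1 / (1 - η) < M) : PolyAbcWith M :=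
  polyAbcWith_of_smallDerivativesOnHitsWith hη0 hη1
    (smallDerivativesOnHitsWith_of_smallDerivativesWith h) hM

/-! ## Skeleton of chain (c) to rung A0 (one hypothesis: the requirement) -/

/-- **Skeleton CF-3 (hits-only envelope) ⟹ `PolyAbcWith (1 + ε)` for every `ε > 0`**: choose
`η = ε / (2(1+ε))`, so that `1/(1−η) = 2(1+ε)/(2+ε) < 1 + ε`. [folklore] -/
theorem polyAbcWith_of_smallDerivativesOnHitsAllExponents (h : SmallDerivativesOnHitsAllExponents)
    {ε : ℝ} (hε : 0 < ε) : PolyAbcWith (1 + ε) := by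
  set η : ℝ := ε / (2 * (1 + ε)) with hη
  have hη0 : 0 < η := by positivity
  have hη1 : η < 1 := by
    rw [hη, div_lt_one (by positivity)]; linarith
  have hM : 1 / (1 - η) < 1 + ε := by
    have h1 : 1 - η = (2 + ε) / (2 * (1 + ε)) := by
      rw [hη]; field_simp; ring
    rw [h1, one_div_div, div_lt_iff₀ (by positivity)]
    nlinarith
  exact polyAbcWith_of_smallDerivativesOnHitsWith hη0 hη1 (h η hη0) hM

/-- **MASON skeleton to A0 (abc form): the hits-only requirement for every `η > 0` ⟹ `ABC`** — the
summit statement itself, via the quantitative Lemma 4.1 and the sheet's `abc_iff_forall_polyAbcWith`.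
Sorry-free with ONE hypothesis. abc is NOT proved by this: the hypothesis is open and «≥ abc».
[folklore] -/
theorem abc_of_smallDerivativesOnHitsAllExponents (h : SmallDerivativesOnHitsAllExponents) :
    _root_.ABC :=
  abc_iff_forall_polyAbcWith.mpr fun _ hε => polyAbcWith_of_smallDerivativesOnHitsAllExponents h hε

/-- **MASON skeleton to A0 (Szpiro `6 + ε` form)**, via the tree's discharged
`Literature.NumberTheory.EllipticCurves.szpiro_of_abcLe_holds` (abc ⇒ Szpiro, Silverman AEC
VIII.11.5(b); this arithmetic step TRANSFERS — chain (c) feeds chain (a)'s conclusion with exponent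
`6`). [folklore] -/
theorem szpiro_of_smallDerivativesOnHitsAllExponents (h : SmallDerivativesOnHitsAllExponents) :
    Literature.NumberTheory.EllipticCurves.SzpiroConjecture :=
  Literature.NumberTheory.EllipticCurves.szpiro_of_abcLe_holds
    fun _ hε => polyAbcWith_of_smallDerivativesOnHitsAllExponents h hε

/-- The sheet's all-triples envelope `SmallDerivativesAllExponents ⟹ ABC`. [folklore] -/
theorem abc_of_smallDerivativesAllExponents (h : SmallDerivativesAllExponents) : _root_.ABC :=
  abc_of_smallDerivativesOnHitsAllExponents (smallDerivativesOnHitsAllExponents_of_allExponents h)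

/-- The sheet's all-triples envelope `SmallDerivativesAllExponents ⟹ SzpiroConjecture`. [folklore] -/
theorem szpiro_of_smallDerivativesAllExponents (h : SmallDerivativesAllExponents) :
    Literature.NumberTheory.EllipticCurves.SzpiroConjecture :=
  szpiro_of_smallDerivativesOnHitsAllExponents (smallDerivativesOnHitsAllExponents_of_allExponents h)

/-! ## The exact transcription `η ≤ 0` is false as typed -/

/-- **The `η ≤ 0` end of the window is FALSE as typed** (lens-3; referee B's vacuity question on
`SmallDerivativesConjectureWith 0`): `c^η ≤ 1` forces `ψ = 0` at every prime, hence `W^ψ(a,b) = 0`, so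
EVERY non-excluded abc triple is exceptional — and `(2, 2k+3, 2k+5)` are infinitely many of them.
Refuted trivially, not by `EpsilonCannotBeDropped`; the honest «η = 0» analogue of the polynomial step
is a polylog bound `‖ψ‖ ≤ C (log c)^A`, refuted by Stewart–Tijdeman through `Pasten.abc_estimate_holds`.
[folklore] -/
theorem not_smallDerivativesWith_of_nonpos {η : ℝ} (hη : η ≤ 0) :
    ¬ Pasten.SmallDerivativesConjectureWith η := by
  intro hfin
  have hf : Function.Injective (fun k : ℕ => ((2 : ℕ), 2 * k + 3, 2 * k + 5)) := by
    intro i j h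
    simp only [Prod.mk.injEq] at h
    omega
  refine ((Set.infinite_range_of_injective hf).mono (Set.range_subset_iff.2 fun k => ?_)) hfin
  simp only [Set.mem_setOf_eq]
  refine ⟨⟨by norm_num, by omega, by ring, ?_⟩, ?_, ?_⟩
  · exact (Nat.Prime.coprime_iff_not_dvd Nat.prime_two).2 (by omega)
  · rintro (⟨h, -⟩ | ⟨h, -⟩) <;> omega
  · rintro ⟨ψ, -, hW, hsmall⟩
    apply hW
    have hc1 : (1 : ℝ) ≤ ((2 * k + 5 : ℕ) : ℝ) := by exact_mod_cast (show 1 ≤ 2 * k + 5 by omega)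
    have hψ : ∀ p : ℕ, ψ p = 0 := by
      intro p
      have h1 := hsmall p
      have h2 : ((2 * k + 5 : ℕ) : ℝ) ^ η ≤ 1 := Real.rpow_le_one_of_one_le_of_nonpos hc1 hη
      have h3 : (|ψ p| : ℝ) < 1 := lt_of_lt_of_le h1 h2
      have h4 : |ψ p| < 1 := by exact_mod_cast h3
      exact Int.abs_lt_one_iff.mp h4
    have hd : ∀ n : ℕ, arithDerivWith ψ n = 0 := by
      intro n
      simp [arithDerivWith, Finsupp.sum, hψ]
    simp [Pasten.wronskian, hd]


/-- So the sheet's envelope cannot be extended to `η = 0`: `¬ ∀ η ≥ 0, R_MS(η)` (row D-8: the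
function-field step has «η = 0»; the arithmetic requirement must keep `η > 0`). [folklore] -/
theorem not_smallDerivativesAllExponents_extended_to_zero :
    ¬ ∀ η : ℝ, 0 ≤ η → Pasten.SmallDerivativesConjectureWith η :=
  fun h => not_smallDerivativesWith_of_nonpos le_rfl (h 0 le_rfl)

end Summit.ABC.FunctionField

end
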